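import Literature.Analysis.ValidatedNumerics.TaylorModelSinCos
import Literature.Analysis.FunctionSpaces.BesselJZeroSeriesRemainder
import HarnessLib

/-!
# Taylor models of `sin ∘ g` and `cos ∘ g` WITHOUT a range condition on the centred argument

Trunk T-ANA (Analysis/ValidatedNumerics); namespace `Literature.Analysis.ValidatedNumerics.PolyMP`.
Companion of `TaylorModelSinCos.lean`. That file models `sin g`, `cos g` by the addition theorems
`sin g = sin c · cos u + cos c · sin u`, `cos g = cos c · cos u − sin c · sin u` (`c = mid0 S G`, `u = g − c`) and
expands `cos u`, `sin u` with the remainder of the complex exponential series (`Complex.exp_bound`), which is why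
its models are ACCEPTED ONLY WHEN `|u| ≤ 1` is certified (`tabsI S h U ≤ S`): an integrand `sin (ω t)` on a panel
of half-width `h` is rejected as soon as `ω h > 1`, and a certificate generator must then subdivide.

Here the small-argument compositions are re-done with the LAGRANGE remainders of the real sine and cosine
series, valid at EVERY real argument and to every order (`Literature.Analysis.FunctionSpaces.abs_cos_sub_sum_range_le`,
`abs_sin_sub_sum_range_le`; DLMF 4.19.1–4.19.2):

  `|cos u − Σ_{l<K} (−1)^l u^{2l}/(2l)!| ≤ |u|^{2K}/(2K)!`,  `|sin u − Σ_{l<K} (−1)^l u^{2l+1}/(2l+1)!| ≤ |u|^{2K+1}/(2K+1)!`.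

This is the generic branch of Joldeş's `TMSin` (Algorithm 2.2.3: coefficients `sin^{(i)}(ξ₀)/i!`, remainder
`V · Γ` with `V ⊇ (I − x₀)^{n+1}` and `Γ ⊇ sin^{(n+1)}(I)/(n+1)!`, here with the enclosure `sin^{(n+1)}(I) ⊆ [−1, 1]`
that holds on ANY interval `I`), organised as in Makino–Berz by the addition theorems so that only the EVEN series in
`w = u²` are evaluated in Taylor-model arithmetic:

* `tpowFactRem S B m n = ⌈S (B/S)^m / n!⌉` — the scaled remainder from a scaled range bound `|u|·S ≤ B`
  (`pow_fact_rem_scaled`);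
* `tcosCompIW S h D K U` / `tsinCompIW S h D K U` — Horner evaluations in `w = u²` of `Σ_{l<K} (−1)^l w^l/(2l)!` and
  `u · Σ_{l<K} (−1)^l w^l/(2l+1)!` (the coefficient lists `cosHalfCoeffs`, `sinHalfCoeffs` of `TaylorModelSinCos.lean`)
  with the remainders `|u|^{2K}/(2K)!`, `|u|^{2K+1}/(2K+1)!` folded into the constant coefficient; sound for EVERY
  `K` and with NO bound on `u` (`tmem_cosCompW`, `tmem_sinCompW`);
* `tsinTMW S h D K Kt kt G` / `tcosTMW S h D K Kt kt G` — the models of `sin ∘ g`, `cos ∘ g` with their acceptance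
  flag, which now only records that the point enclosure `cisPt S Kt kt (ofRat S c)` of `(cos c, sin c)` was accepted
  (`tmem_sin_of_tsinTMW`, `tmem_cos_of_tcosTMW`); same signatures as `tsinTM` / `tcosTM`, so a certificate checker
  can use either.
* `tcosCompIWS` / `tsinCompIWS` and `tsinTMWS` / `tcosTMWS` (`tmem_cosCompWS`, `tmem_sinCompWS`,
  `tmem_sin_of_tsinTMWS`, `tmem_cos_of_tcosTMWS`) — the same models with the even series evaluated in the SCALED
  variable `w' = u²/4^m ≤ 1` (`m = wideExp S B`, `2^m > ⌊B/S⌋ ≥ |u|`) against the coefficients `(−1)^l 4^{ml}/(2l)!`,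
  `(−1)^l 4^{ml}/(2l+1)!`. In the fixed-point interval arithmetic at scale `S` every series coefficient is rounded
  outward by one unit and Horner's rule in `w` multiplies the rounding of the `l`-th coefficient by `w^l` — for
  `|u| ≤ 2.5`, `K = 20` that is `6.25^19 ≈ 2^50` units — whereas in `w'` the amplification is `≤ 1`; the price is
  the size `≤ cosh 2^m` of the scaled coefficients (the cancellation of the alternating series at a large argument),
  so operands with `|u| ≫ 1` still call for subdivision or a larger `S`. These are the forms to use when `|u| > 1`;
  soundness uses only `4^m ≠ 0`.

On `|u| ≤ 1` the new remainders are also SHARPER than the common remainder `|u|^{2K}(2K+1)/((2K)!·2K)` of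
`TaylorModelSinCos.lean` (by the factors `2K/(2K+1)` and `|u|·2K/(2K+1)²`). Problem-independent plumbing for
kernel-checked integral certificates with oscillatory integrands; no facts, no axioms.

## References

* M. Joldeş, *Rigorous Polynomial Approximations and Applications*, PhD thesis, ENS Lyon (2011): Algorithm 2.2.3
  `TMSin` and its proof (Taylor model of `sin` on an arbitrary interval `I` around `x₀ ⊆ I`: coefficients
  `sin^{(i)}(x₀)/i!` by `i mod 4`, remainder `Δ = V · Γ`, `Γ = eval(± sin or ± cos /(n+1)!, I)`, thesis pp. 52–53),
  and Algorithm 2.2.8 `TMComp` (composition with a basic function: split off the constant coefficient, thesis p. 60).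
  [cite: Joldes2011, Algorithm 2.2.3]
* K. Makino, M. Berz, *Taylor models and other validated functional inclusion methods*, Int. J. Pure Appl.
  Math. 4 (2003) 379–456 (Taylor-model intrinsics by addition theorems; `sin`/`cos` eq. (2.10)–(2.11)).
  [cite: MakinoBerz2003, passim]
* NIST DLMF 4.19.1–4.19.2 (Maclaurin series of `sin`, `cos`; Lagrange remainders at every real point:
  `Literature.Analysis.FunctionSpaces.abs_sin_sub_sum_range_le`, `abs_cos_sub_sum_range_le`). [cite: DLMF, 4.19.1]
* R. P. Brent, P. Zimmermann, *Modern Computer Arithmetic*, Cambridge Univ. Press (2010), §4.3.1, §4.8.5 (the point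
  values `cos c + i sin c = exp(ic)` by `k` squarings, `cisPt` of `TaylorModelSinCos.lean`). [cite: BrentZimmermann2010, §4.3.1]
-/

namespace Literature.Analysis.ValidatedNumerics

namespace PolyMP

open Literature.Analysis.ValidatedNumerics.NumericsMP
open Literature.Analysis.ValidatedNumerics.ExpPoly (Poly)

/-! ### The even series in `w = u²` (restated with the summands of the Lagrange-remainder lemmas) -/

/-- `P_cos(u²) = Σ_{l<K} (−1)^l u^{2l}/(2l)!`. [folklore] -/
private theorem eval_cosHalfCoeffs_mul_self (K : ℕ) (u : ℝ) :
    Poly.eval (cosHalfCoeffs K) (u * u) = ∑ l ∈ Finset.range K, (-1 : ℝ) ^ l * u ^ (2 * l) / (2 * l).factorial := by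
  rw [cosHalfCoeffs, poly_eval_map_range]
  refine Finset.sum_congr rfl fun l _ => ?_
  rw [← sq, ← pow_mul]
  push_cast
  ring

/-- `u · P_sin(u²) = Σ_{l<K} (−1)^l u^{2l+1}/(2l+1)!`. [folklore] -/
private theorem mul_eval_sinHalfCoeffs_mul_self (K : ℕ) (u : ℝ) :
    u * Poly.eval (sinHalfCoeffs K) (u * u) =
      ∑ l ∈ Finset.range K, (-1 : ℝ) ^ l * u ^ (2 * l + 1) / (2 * l + 1).factorial := by
  rw [sinHalfCoeffs, poly_eval_map_range, Finset.mul_sum]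
  refine Finset.sum_congr rfl fun l _ => ?_
  rw [← sq, ← pow_mul, pow_succ]
  push_cast
  ring

/-! ### The scaled Lagrange remainder `⌈S (B/S)^m / n!⌉` -/

/-- Scaled remainder bound `⌈S (B/S)^m / n!⌉` from a scaled range bound `B` (`|u|·S ≤ B`): with `m = n = 2K` it
bounds `S·|u|^{2K}/(2K)!` (cosine), with `m = n = 2K+1` it bounds `S·|u|^{2K+1}/(2K+1)!` (sine). [folklore] -/
def tpowFactRem (S : ℕ) (B : ℤ) (m n : ℕ) : ℤ :=
  ⌈(S : ℚ) * (((B : ℚ) / S) ^ m / (n.factorial : ℚ))⌉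

/-- The scaled remainder estimate: `|u| ≤ B/S` and `|r| ≤ |u|^m/n!` give `|r|·S ≤ tpowFactRem S B m n`. [folklore] -/
private theorem pow_fact_rem_scaled {S : ℕ} (hS : 0 < S) {B : ℤ} {m n : ℕ} {u r : ℝ} (huB : |u| ≤ (B : ℝ) / S)
    (hr : |r| ≤ |u| ^ m / (n.factorial : ℝ)) :
    |r| * S ≤ (tpowFactRem S B m n : ℝ) := by
  have hSr : (0 : ℝ) < S := by exact_mod_cast hS
  have h2 : |u| ^ m ≤ ((B : ℝ) / S) ^ m := pow_le_pow_left₀ (abs_nonneg _) huB _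
  have hc : (0 : ℝ) < (n.factorial : ℝ) := by positivity
  have h3 : |r| ≤ ((B : ℝ) / S) ^ m / (n.factorial : ℝ) := hr.trans (div_le_div_of_nonneg_right h2 hc.le)
  have h4 : ((S : ℚ) * ((((B : ℚ) / S) ^ m) / (n.factorial : ℚ)) : ℝ) ≤ (tpowFactRem S B m n : ℝ) := by
    unfold tpowFactRem; exact_mod_cast Int.le_ceil _
  refine le_trans ?_ h4
  push_cast
  rw [mul_comm ((S : ℕ) : ℝ)]
  exact mul_le_mul_of_nonneg_right h3 hSr.le

/-! ### `cos ∘ u` and `sin ∘ u` for ANY Taylor-modelled `u` -/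

/-- The Taylor model of `ρ ↦ cos (u ρ)`: Horner on `cosHalfCoeffs K` at the model of `u²`, plus the Lagrange
remainder `|u|^{2K}/(2K)!` — no range condition. [cite: Joldes2011, Algorithm 2.2.3] -/
def tcosCompIW (S : ℕ) (h : ℚ) (D K : ℕ) (U : IPoly) : IPoly :=
  widen0 (thornerI S h D (cosHalfCoeffs K) (tmulI S h D U U)) (tpowFactRem S (tabsI S h U) (2 * K) (2 * K))

/-- The Taylor model of `ρ ↦ sin (u ρ)`: `U ·` Horner on `sinHalfCoeffs K` at the model of `u²`, plus the Lagrange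
remainder `|u|^{2K+1}/(2K+1)!` — no range condition. [cite: Joldes2011, Algorithm 2.2.3] -/
def tsinCompIW (S : ℕ) (h : ℚ) (D K : ℕ) (U : IPoly) : IPoly :=
  widen0 (tmulI S h D U (thornerI S h D (sinHalfCoeffs K) (tmulI S h D U U)))
    (tpowFactRem S (tabsI S h U) (2 * K + 1) (2 * K + 1))

/-- **Soundness of `tcosCompIW`**, for every `K` and every modelled `u`. [cite: Joldes2011, Algorithm 2.2.3] -/
theorem tmem_cosCompW {S : ℕ} (hS : 0 < S) {h : ℚ} (h0 : 0 ≤ h) (D K : ℕ) {u : ℝ → ℝ} {U : IPoly}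
    (hu : TMem S h u U) : TMem S h (fun ρ => Real.cos (u ρ)) (tcosCompIW S h D K U) := by
  intro ρ hρ
  have hW : TMem S h (fun ρ => u ρ * u ρ) (tmulI S h D U U) := tmem_mul hS h0 D hu hu
  obtain ⟨as, has, hev⟩ := tmem_horner hS h0 D hW (cosHalfCoeffs K) ρ hρ
  have hSr : (0 : ℝ) < S := by exact_mod_cast hS
  have huB : |u ρ| ≤ ((tabsI S h U : ℤ) : ℝ) / S := by rw [le_div_iff₀ hSr]; exact abs_le_tabsI h0 hu hρ
  have hrem := Literature.Analysis.FunctionSpaces.abs_cos_sub_sum_range_le (u ρ) K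
  rw [← eval_cosHalfCoeffs_mul_self] at hrem
  have hδle := pow_fact_rem_scaled hS huB hrem
  obtain ⟨bs, hbs, hev2⟩ := exists_widen0 has hδle ρ
  refine ⟨bs, hbs, ?_⟩
  rw [hev2, ← hev]
  ring

/-- **Soundness of `tsinCompIW`**, for every `K` and every modelled `u`. [cite: Joldes2011, Algorithm 2.2.3] -/
theorem tmem_sinCompW {S : ℕ} (hS : 0 < S) {h : ℚ} (h0 : 0 ≤ h) (D K : ℕ) {u : ℝ → ℝ} {U : IPoly}
    (hu : TMem S h u U) : TMem S h (fun ρ => Real.sin (u ρ)) (tsinCompIW S h D K U) := by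
  intro ρ hρ
  have hW : TMem S h (fun ρ => u ρ * u ρ) (tmulI S h D U U) := tmem_mul hS h0 D hu hu
  have hP := tmem_mul hS h0 D hu (tmem_horner hS h0 D hW (sinHalfCoeffs K))
  obtain ⟨as, has, hev⟩ := hP ρ hρ
  have hSr : (0 : ℝ) < S := by exact_mod_cast hS
  have huB : |u ρ| ≤ ((tabsI S h U : ℤ) : ℝ) / S := by rw [le_div_iff₀ hSr]; exact abs_le_tabsI h0 hu hρ
  have hrem := Literature.Analysis.FunctionSpaces.abs_sin_sub_sum_range_le (u ρ) K
  rw [← mul_eval_sinHalfCoeffs_mul_self] at hrem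
  have hδle := pow_fact_rem_scaled hS huB hrem
  obtain ⟨bs, hbs, hev2⟩ := exists_widen0 has hδle ρ
  refine ⟨bs, hbs, ?_⟩
  rw [hev2, ← hev]
  ring

/-! ### `sin ∘ g` and `cos ∘ g` without range condition -/

/-- The Taylor model of `sin ∘ g` with its acceptance flag: `c = mid0 S G`, `u = g − c`,
`sin g = sin c · cos u + cos c · sin u`, `(cos c, sin c) ∈ cisPt S Kt kt (ofRat S c)`; the flag records only the
acceptance of the point enclosure. Same signature as `tsinTM`. [cite: Joldes2011, Algorithm 2.2.3] -/
def tsinTMW (S : ℕ) (h : ℚ) (D K Kt kt : ℕ) (G : IPoly) : IPoly × Bool :=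
  let U := tcentre S G
  match cisPt S Kt kt (ofRat S (mid0 S G)) with
  | none => ([], false)
  | some E => (taddI (tsmulI S E.im (tcosCompIW S h D K U)) (tsmulI S E.re (tsinCompIW S h D K U)), true)

/-- The Taylor model of `cos ∘ g` with its acceptance flag: `c = mid0 S G`, `u = g − c`,
`cos g = cos c · cos u − sin c · sin u`, `(cos c, sin c) ∈ cisPt S Kt kt (ofRat S c)`; the flag records only the
acceptance of the point enclosure. Same signature as `tcosTM`. [cite: Joldes2011, Algorithm 2.2.3] -/
def tcosTMW (S : ℕ) (h : ℚ) (D K Kt kt : ℕ) (G : IPoly) : IPoly × Bool :=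
  let U := tcentre S G
  match cisPt S Kt kt (ofRat S (mid0 S G)) with
  | none => ([], false)
  | some E => (tsubI (tsmulI S E.re (tcosCompIW S h D K U)) (tsmulI S E.im (tsinCompIW S h D K U)), true)

/-- **Soundness of `tsinTMW`.** [cite: Joldes2011, Algorithm 2.2.3] -/
theorem tmem_sin_of_tsinTMW {S : ℕ} (hS : 0 < S) {h : ℚ} (h0 : 0 ≤ h) {D K Kt kt : ℕ} {g : ℝ → ℝ} {G : IPoly}
    (hg : TMem S h g G) (hok : (tsinTMW S h D K Kt kt G).2 = true) :
    TMem S h (fun ρ => Real.sin (g ρ)) (tsinTMW S h D K Kt kt G).1 := by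
  unfold tsinTMW at hok ⊢
  rcases hE : cisPt S Kt kt (ofRat S (mid0 S G)) with _ | E
  · simp only [hE] at hok; exact absurd hok Bool.false_ne_true
  · dsimp only
    have hc := mem_ofRat S (mid0 S G)
    have hcos := mem_cos_of_cisPt hS hE hc
    have hsin := mem_sin_of_cisPt hS hE hc
    have hU := tmem_centre hg
    have hsum := tmem_add (tmem_smulI hS hsin (tmem_cosCompW hS h0 D K hU))
      (tmem_smulI hS hcos (tmem_sinCompW hS h0 D K hU))
    intro ρ hρ
    obtain ⟨as, has, hev⟩ := hsum ρ hρ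
    refine ⟨as, has, ?_⟩
    rw [← hev]
    show Real.sin (g ρ) = Real.sin ((mid0 S G : ℚ) : ℝ) * Real.cos (g ρ - ((mid0 S G : ℚ) : ℝ)) +
      Real.cos ((mid0 S G : ℚ) : ℝ) * Real.sin (g ρ - ((mid0 S G : ℚ) : ℝ))
    rw [← Real.sin_add]
    congr 1
    ring

/-- **Soundness of `tcosTMW`.** [cite: Joldes2011, Algorithm 2.2.3] -/
theorem tmem_cos_of_tcosTMW {S : ℕ} (hS : 0 < S) {h : ℚ} (h0 : 0 ≤ h) {D K Kt kt : ℕ} {g : ℝ → ℝ} {G : IPoly}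
    (hg : TMem S h g G) (hok : (tcosTMW S h D K Kt kt G).2 = true) :
    TMem S h (fun ρ => Real.cos (g ρ)) (tcosTMW S h D K Kt kt G).1 := by
  unfold tcosTMW at hok ⊢
  rcases hE : cisPt S Kt kt (ofRat S (mid0 S G)) with _ | E
  · simp only [hE] at hok; exact absurd hok Bool.false_ne_true
  · dsimp only
    have hc := mem_ofRat S (mid0 S G)
    have hcos := mem_cos_of_cisPt hS hE hc
    have hsin := mem_sin_of_cisPt hS hE hc
    have hU := tmem_centre hg
    have hdiff := tmem_sub (tmem_smulI hS hcos (tmem_cosCompW hS h0 D K hU))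
      (tmem_smulI hS hsin (tmem_sinCompW hS h0 D K hU))
    intro ρ hρ
    obtain ⟨as, has, hev⟩ := hdiff ρ hρ
    refine ⟨as, has, ?_⟩
    rw [← hev]
    show Real.cos (g ρ) = Real.cos ((mid0 S G : ℚ) : ℝ) * Real.cos (g ρ - ((mid0 S G : ℚ) : ℝ)) -
      Real.sin ((mid0 S G : ℚ) : ℝ) * Real.sin (g ρ - ((mid0 S G : ℚ) : ℝ))
    rw [← Real.cos_add]
    congr 1
    ring

/-! ### Scaled evaluation for centred arguments beyond `1`

`tcosCompIW` / `tsinCompIW` evaluate the even series by Horner's rule in `w = u²` with the coefficients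
`(−1)^l/(2l)!`, `(−1)^l/(2l+1)!` rounded outward to one unit of the scale `S`.  For `|u| ≤ 1` this is harmless; for
`|u| > 1` the rounding of the `l`-th coefficient is multiplied by `w^l` on the way down, so a panel with `|u| ≤ 2.5`
and `K = 20` loses `6.25^19 ≈ 2^50` units of the scale.  The scaled forms below evaluate instead in
`w' = u²/4^m ≤ 1`, `2^m > ⌊B/S⌋ ≥ |u|` (`B = tabsI S h U`, `m = wideExp S B`), with the coefficients
`(−1)^l 4^{ml}/(2l)!`, `(−1)^l 4^{ml}/(2l+1)!` (bounded by `cosh 2^m`), which is the classical scaling of a truncated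
series to the unit disc before Horner evaluation; the remainder terms are unchanged.  Soundness uses only `4^m ≠ 0`. -/

/-- Bit length of `q` by structural recursion on a fuel argument: the least `m ≤ fuel` with `q < 2^m` when
`q < 2^fuel` (else `fuel`). [folklore] -/
def wideExpAux : ℕ → ℕ → ℕ
  | 0, _ => 0
  | fuel + 1, q => if q = 0 then 0 else wideExpAux fuel (q / 2) + 1

/-- The scaling exponent `m` of a centred argument with scaled range bound `B` (`|u|·S ≤ B`): `⌊B/S⌋ < 2^m` for
`B < 2^64 S`, so that `u²/4^m ≤ 1`. Only `4^m ≠ 0` is used for soundness. [folklore] -/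
def wideExp (S : ℕ) (B : ℤ) : ℕ := wideExpAux 64 (B.toNat / S)

/-- Coefficients `(−1)^l W^l/(2l)!`, `l < K`, of `cos u` as a polynomial in `w' = u²/W`. [folklore] -/
def cosHalfCoeffsSc (K : ℕ) (W : ℚ) : List ℚ :=
  (List.range K).map fun l : ℕ => (-1 : ℚ) ^ l * W ^ l / ((2 * l).factorial : ℚ)

/-- Coefficients `(−1)^l W^l/(2l+1)!`, `l < K`, of `sin u / u` as a polynomial in `w' = u²/W`. [folklore] -/
def sinHalfCoeffsSc (K : ℕ) (W : ℚ) : List ℚ :=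
  (List.range K).map fun l : ℕ => (-1 : ℚ) ^ l * W ^ l / ((2 * l + 1).factorial : ℚ)

/-- `P_cos^W(v) = Σ_{l<K} (−1)^l u^{2l}/(2l)!` whenever `W·v = u²`. [folklore] -/
private theorem eval_cosHalfCoeffsSc (K : ℕ) (W : ℚ) {u v : ℝ} (hv : (W : ℝ) * v = u * u) :
    Poly.eval (cosHalfCoeffsSc K W) v = ∑ l ∈ Finset.range K, (-1 : ℝ) ^ l * u ^ (2 * l) / (2 * l).factorial := by
  rw [cosHalfCoeffsSc, poly_eval_map_range]
  refine Finset.sum_congr rfl fun l _ => ?_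
  have e : (W : ℝ) ^ l * v ^ l = u ^ (2 * l) := by rw [← mul_pow, hv, ← sq, ← pow_mul]
  push_cast
  rw [div_mul_eq_mul_div, mul_assoc, e]

/-- `u · P_sin^W(v) = Σ_{l<K} (−1)^l u^{2l+1}/(2l+1)!` whenever `W·v = u²`. [folklore] -/
private theorem mul_eval_sinHalfCoeffsSc (K : ℕ) (W : ℚ) {u v : ℝ} (hv : (W : ℝ) * v = u * u) :
    u * Poly.eval (sinHalfCoeffsSc K W) v =
      ∑ l ∈ Finset.range K, (-1 : ℝ) ^ l * u ^ (2 * l + 1) / (2 * l + 1).factorial := by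
  rw [sinHalfCoeffsSc, poly_eval_map_range, Finset.mul_sum]
  refine Finset.sum_congr rfl fun l _ => ?_
  have e : (W : ℝ) ^ l * v ^ l = u ^ (2 * l) := by rw [← mul_pow, hv, ← sq, ← pow_mul]
  push_cast
  rw [div_mul_eq_mul_div, mul_assoc ((-1 : ℝ) ^ l), e, pow_succ]
  ring

/-- The scaling identity `4^m · ((1/4^m) · u²) = u²` in `ℝ`. [folklore] -/
private theorem four_pow_mul_inv_mul (m : ℕ) (x : ℝ) :
    (((4 : ℚ) ^ m : ℚ) : ℝ) * (((((1 : ℚ) / (4 : ℚ) ^ m : ℚ)) : ℝ) * x) = x := by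
  push_cast
  field_simp

/-- The Taylor model of `ρ ↦ cos (u ρ)` for ANY modelled `u`, evaluated in the scaled variable `u²/4^m`,
`m = wideExp S (tabsI S h U)`, plus the Lagrange remainder `|u|^{2K}/(2K)!`. [cite: Joldes2011, Algorithm 2.2.3] -/
def tcosCompIWS (S : ℕ) (h : ℚ) (D K : ℕ) (U : IPoly) : IPoly :=
  let B := tabsI S h U
  let W : ℚ := 4 ^ wideExp S B
  widen0 (thornerI S h D (cosHalfCoeffsSc K W) (tsmulI S (ofRat S (1 / W)) (tmulI S h D U U)))
    (tpowFactRem S B (2 * K) (2 * K))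

/-- The Taylor model of `ρ ↦ sin (u ρ)` for ANY modelled `u`, evaluated in the scaled variable `u²/4^m`, plus the
Lagrange remainder `|u|^{2K+1}/(2K+1)!`. [cite: Joldes2011, Algorithm 2.2.3] -/
def tsinCompIWS (S : ℕ) (h : ℚ) (D K : ℕ) (U : IPoly) : IPoly :=
  let B := tabsI S h U
  let W : ℚ := 4 ^ wideExp S B
  widen0 (tmulI S h D U (thornerI S h D (sinHalfCoeffsSc K W) (tsmulI S (ofRat S (1 / W)) (tmulI S h D U U))))
    (tpowFactRem S B (2 * K + 1) (2 * K + 1))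

/-- **Soundness of `tcosCompIWS`**, for every `K` and every modelled `u`. [cite: Joldes2011, Algorithm 2.2.3] -/
theorem tmem_cosCompWS {S : ℕ} (hS : 0 < S) {h : ℚ} (h0 : 0 ≤ h) (D K : ℕ) {u : ℝ → ℝ} {U : IPoly}
    (hu : TMem S h u U) : TMem S h (fun ρ => Real.cos (u ρ)) (tcosCompIWS S h D K U) := by
  intro ρ hρ
  have hW : TMem S h (fun ρ => ((((1 : ℚ) / (4 : ℚ) ^ wideExp S (tabsI S h U) : ℚ)) : ℝ) * (u ρ * u ρ))
      (tsmulI S (ofRat S (1 / (4 : ℚ) ^ wideExp S (tabsI S h U))) (tmulI S h D U U)) :=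
    tmem_smulI hS (mem_ofRat S _) (tmem_mul hS h0 D hu hu)
  obtain ⟨as, has, hev⟩ := tmem_horner hS h0 D hW (cosHalfCoeffsSc K ((4 : ℚ) ^ wideExp S (tabsI S h U))) ρ hρ
  have hSr : (0 : ℝ) < S := by exact_mod_cast hS
  have huB : |u ρ| ≤ ((tabsI S h U : ℤ) : ℝ) / S := by rw [le_div_iff₀ hSr]; exact abs_le_tabsI h0 hu hρ
  have hrem := Literature.Analysis.FunctionSpaces.abs_cos_sub_sum_range_le (u ρ) K
  rw [← eval_cosHalfCoeffsSc K ((4 : ℚ) ^ wideExp S (tabsI S h U)) (four_pow_mul_inv_mul _ (u ρ * u ρ))] at hrem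
  have hδle := pow_fact_rem_scaled hS huB hrem
  obtain ⟨bs, hbs, hev2⟩ := exists_widen0 has hδle ρ
  refine ⟨bs, hbs, ?_⟩
  rw [hev2, ← hev]
  ring

/-- **Soundness of `tsinCompIWS`**, for every `K` and every modelled `u`. [cite: Joldes2011, Algorithm 2.2.3] -/
theorem tmem_sinCompWS {S : ℕ} (hS : 0 < S) {h : ℚ} (h0 : 0 ≤ h) (D K : ℕ) {u : ℝ → ℝ} {U : IPoly}
    (hu : TMem S h u U) : TMem S h (fun ρ => Real.sin (u ρ)) (tsinCompIWS S h D K U) := by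
  intro ρ hρ
  have hW : TMem S h (fun ρ => ((((1 : ℚ) / (4 : ℚ) ^ wideExp S (tabsI S h U) : ℚ)) : ℝ) * (u ρ * u ρ))
      (tsmulI S (ofRat S (1 / (4 : ℚ) ^ wideExp S (tabsI S h U))) (tmulI S h D U U)) :=
    tmem_smulI hS (mem_ofRat S _) (tmem_mul hS h0 D hu hu)
  have hP := tmem_mul hS h0 D hu (tmem_horner hS h0 D hW (sinHalfCoeffsSc K ((4 : ℚ) ^ wideExp S (tabsI S h U))))
  obtain ⟨as, has, hev⟩ := hP ρ hρ
  have hSr : (0 : ℝ) < S := by exact_mod_cast hS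
  have huB : |u ρ| ≤ ((tabsI S h U : ℤ) : ℝ) / S := by rw [le_div_iff₀ hSr]; exact abs_le_tabsI h0 hu hρ
  have hrem := Literature.Analysis.FunctionSpaces.abs_sin_sub_sum_range_le (u ρ) K
  rw [← mul_eval_sinHalfCoeffsSc K ((4 : ℚ) ^ wideExp S (tabsI S h U)) (four_pow_mul_inv_mul _ (u ρ * u ρ))] at hrem
  have hδle := pow_fact_rem_scaled hS huB hrem
  obtain ⟨bs, hbs, hev2⟩ := exists_widen0 has hδle ρ
  refine ⟨bs, hbs, ?_⟩
  rw [hev2, ← hev]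
  ring

/-- The Taylor model of `sin ∘ g` with scaled evaluation of the centred series, with its acceptance flag (the point
enclosure `cisPt` accepted); same signature as `tsinTM` / `tsinTMW`. [cite: Joldes2011, Algorithm 2.2.3] -/
def tsinTMWS (S : ℕ) (h : ℚ) (D K Kt kt : ℕ) (G : IPoly) : IPoly × Bool :=
  let U := tcentre S G
  match cisPt S Kt kt (ofRat S (mid0 S G)) with
  | none => ([], false)
  | some E => (taddI (tsmulI S E.im (tcosCompIWS S h D K U)) (tsmulI S E.re (tsinCompIWS S h D K U)), true)

/-- The Taylor model of `cos ∘ g` with scaled evaluation of the centred series, with its acceptance flag; same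
signature as `tcosTM` / `tcosTMW`. [cite: Joldes2011, Algorithm 2.2.3] -/
def tcosTMWS (S : ℕ) (h : ℚ) (D K Kt kt : ℕ) (G : IPoly) : IPoly × Bool :=
  let U := tcentre S G
  match cisPt S Kt kt (ofRat S (mid0 S G)) with
  | none => ([], false)
  | some E => (tsubI (tsmulI S E.re (tcosCompIWS S h D K U)) (tsmulI S E.im (tsinCompIWS S h D K U)), true)

/-- **Soundness of `tsinTMWS`.** [cite: Joldes2011, Algorithm 2.2.3] -/
theorem tmem_sin_of_tsinTMWS {S : ℕ} (hS : 0 < S) {h : ℚ} (h0 : 0 ≤ h) {D K Kt kt : ℕ} {g : ℝ → ℝ} {G : IPoly}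
    (hg : TMem S h g G) (hok : (tsinTMWS S h D K Kt kt G).2 = true) :
    TMem S h (fun ρ => Real.sin (g ρ)) (tsinTMWS S h D K Kt kt G).1 := by
  unfold tsinTMWS at hok ⊢
  rcases hE : cisPt S Kt kt (ofRat S (mid0 S G)) with _ | E
  · simp only [hE] at hok; exact absurd hok Bool.false_ne_true
  · dsimp only
    have hc := mem_ofRat S (mid0 S G)
    have hcos := mem_cos_of_cisPt hS hE hc
    have hsin := mem_sin_of_cisPt hS hE hc
    have hU := tmem_centre hg
    have hsum := tmem_add (tmem_smulI hS hsin (tmem_cosCompWS hS h0 D K hU))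
      (tmem_smulI hS hcos (tmem_sinCompWS hS h0 D K hU))
    intro ρ hρ
    obtain ⟨as, has, hev⟩ := hsum ρ hρ
    refine ⟨as, has, ?_⟩
    rw [← hev]
    show Real.sin (g ρ) = Real.sin ((mid0 S G : ℚ) : ℝ) * Real.cos (g ρ - ((mid0 S G : ℚ) : ℝ)) +
      Real.cos ((mid0 S G : ℚ) : ℝ) * Real.sin (g ρ - ((mid0 S G : ℚ) : ℝ))
    rw [← Real.sin_add]
    congr 1
    ring

/-- **Soundness of `tcosTMWS`.** [cite: Joldes2011, Algorithm 2.2.3] -/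
theorem tmem_cos_of_tcosTMWS {S : ℕ} (hS : 0 < S) {h : ℚ} (h0 : 0 ≤ h) {D K Kt kt : ℕ} {g : ℝ → ℝ} {G : IPoly}
    (hg : TMem S h g G) (hok : (tcosTMWS S h D K Kt kt G).2 = true) :
    TMem S h (fun ρ => Real.cos (g ρ)) (tcosTMWS S h D K Kt kt G).1 := by
  unfold tcosTMWS at hok ⊢
  rcases hE : cisPt S Kt kt (ofRat S (mid0 S G)) with _ | E
  · simp only [hE] at hok; exact absurd hok Bool.false_ne_true
  · dsimp only
    have hc := mem_ofRat S (mid0 S G)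
    have hcos := mem_cos_of_cisPt hS hE hc
    have hsin := mem_sin_of_cisPt hS hE hc
    have hU := tmem_centre hg
    have hdiff := tmem_sub (tmem_smulI hS hcos (tmem_cosCompWS hS h0 D K hU))
      (tmem_smulI hS hsin (tmem_sinCompWS hS h0 D K hU))
    intro ρ hρ
    obtain ⟨as, has, hev⟩ := hdiff ρ hρ
    refine ⟨as, has, ?_⟩
    rw [← hev]
    show Real.cos (g ρ) = Real.cos ((mid0 S G : ℚ) : ℝ) * Real.cos (g ρ - ((mid0 S G : ℚ) : ℝ)) -
      Real.sin ((mid0 S G : ℚ) : ℝ) * Real.sin (g ρ - ((mid0 S G : ℚ) : ℝ))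
    rw [← Real.cos_add]
    congr 1
    ring

end PolyMP

end Literature.Analysis.ValidatedNumerics
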